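import Literature.MathematicalPhysics.StatisticalMechanics.HcpFccLatticeSumsEval

/-!
# Certified hcp/fcc lattice sums: squares, shells and tail bounds in a layer

For the layer sums `layerSum δ n s = ∑_{(i,j) ∈ ℤ²} (Q_δ(i,j) + s)⁻ⁿ` (`HcpFccLatticeSums.lean`):
the shell lower bounds `Q₀ ≥ (3/4) m²`, `Q₁ ≥ m²/3` when `max(|i|,|j|) = m ≥ 1`; the shells
`box m ∖ box (m-1)` (`8m` sites); the convexity step
`d (B − A) B^{-(d+1)} ≤ A^{-d} − B^{-d}` (`inv_pow_sub_inv_pow_ge`, from the factorisation of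
`B^d − A^d`) and the telescoping shell estimate
`∑_{m>R} 8m (α m² + s)^{-(d+1)} ≤ (8/(α d)) (α R² + s)^{-d}`; consequences: summability of the layer
sums (`n ≥ 2`, `s ≥ 0`), the two-sided truncation
`∑_{box R} ≤ layerSum ≤ ∑_{box R} + (8/(α_δ d)) (α_δ R² + s)^{-d}`, the same bound for the tail
`∑'_{∉ box R}`, and the full-layer bound `layerSum δ (d+1) s ≤ s^{-(d+1)} + (8/(α_δ d)) s^{-d}`
(`s > 0`).  [folklore]
-/

noncomputable section

namespace Literature.MathematicalPhysics.StatisticalMechanics.StackingSums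

open Finset

/-! ## Shell lower bounds for the forms -/

/-- `Q₀ ≥ (3/4) i²` and `Q₀ ≥ (3/4) j²`. [folklore] -/
theorem stackForm_zero_ge (i j : ℤ) :
    3 / 4 * (i : ℝ) ^ 2 ≤ stackForm 0 i j ∧ 3 / 4 * (j : ℝ) ^ 2 ≤ stackForm 0 i j := by
  rw [stackForm_zero]
  constructor
  · nlinarith [sq_nonneg ((i : ℝ) / 2 + j)]
  · nlinarith [sq_nonneg ((j : ℝ) / 2 + i)]

/-- **Shell bound, aligned form**: `max(|i|,|j|) ≥ m ⇒ Q₀ ≥ (3/4) m²`. [folklore] -/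
theorem stackForm_zero_shell (m : ℕ) (i j : ℤ) (h : (m : ℤ) ≤ |i| ∨ (m : ℤ) ≤ |j|) :
    3 / 4 * (m : ℝ) ^ 2 ≤ stackForm 0 i j := by
  obtain ⟨hi, hj⟩ := stackForm_zero_ge i j
  rcases h with h | h
  · have h' : (m : ℝ) ≤ |(i : ℝ)| := by rw [← Int.cast_abs]; exact_mod_cast h
    have : (m : ℝ) ^ 2 ≤ (i : ℝ) ^ 2 := by
      calc (m : ℝ) ^ 2 ≤ |(i : ℝ)| ^ 2 := pow_le_pow_left₀ (by positivity) h' 2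
        _ = _ := sq_abs _
    linarith
  · have h' : (m : ℝ) ≤ |(j : ℝ)| := by rw [← Int.cast_abs]; exact_mod_cast h
    have : (m : ℝ) ^ 2 ≤ (j : ℝ) ^ 2 := by
      calc (m : ℝ) ^ 2 ≤ |(j : ℝ)| ^ 2 := pow_le_pow_left₀ (by positivity) h' 2
        _ = _ := sq_abs _
    linarith

/-- `Q₁ ≥ (3/4)(j + 1/3)²` and, by the symmetry `i ↔ j`, `Q₁ ≥ (3/4)(i + 1/3)²`. [folklore] -/
theorem stackForm_one_ge (i j : ℤ) :
    3 / 4 * ((i : ℝ) + 1 / 3) ^ 2 ≤ stackForm 1 i j ∧ 3 / 4 * ((j : ℝ) + 1 / 3) ^ 2 ≤ stackForm 1 i j := by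
  rw [stackForm_one]
  constructor
  · nlinarith [sq_nonneg ((j : ℝ) + i / 2 + 1 / 2)]
  · nlinarith [sq_nonneg ((i : ℝ) + j / 2 + 1 / 2)]

/-- For an integer `i` with `|i| ≥ m ≥ 1`: `(i + 1/3)² ≥ (4/9) m²`. [folklore] -/
theorem sq_add_third_ge {m : ℕ} (hm : 1 ≤ m) {i : ℤ} (h : (m : ℤ) ≤ |i|) :
    4 / 9 * (m : ℝ) ^ 2 ≤ ((i : ℝ) + 1 / 3) ^ 2 := by
  have hm1 : (1 : ℝ) ≤ m := by exact_mod_cast hm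
  rcases le_or_gt 0 i with hi | hi
  · rw [abs_of_nonneg hi] at h
    have h' : (m : ℝ) ≤ i := by exact_mod_cast h
    nlinarith
  · rw [abs_of_neg hi] at h
    have h' : (i : ℝ) ≤ -m := by
      have : i ≤ -(m : ℤ) := by omega
      exact_mod_cast this
    nlinarith

/-- **Shell bound, offset form**: `max(|i|,|j|) ≥ m ≥ 1 ⇒ Q₁ ≥ m²/3`. [folklore] -/
theorem stackForm_one_shell {m : ℕ} (hm : 1 ≤ m) (i j : ℤ) (h : (m : ℤ) ≤ |i| ∨ (m : ℤ) ≤ |j|) :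
    1 / 3 * (m : ℝ) ^ 2 ≤ stackForm 1 i j := by
  obtain ⟨hi, hj⟩ := stackForm_one_ge i j
  rcases h with h | h
  · have := sq_add_third_ge hm h
    linarith
  · have := sq_add_third_ge hm h
    linarith

/-- The shell constant of pattern `δ`: `3/4` (aligned) resp. `1/3` (offset); as a hypothesis-free
package: for `δ ≤ 1`, `m ≥ 1` and `max(|i|,|j|) ≥ m`,
`(if δ = 0 then 3/4 else 1/3) · m² ≤ stackForm δ i j`. [folklore] -/
theorem stackForm_shell {δ : ℕ} (hδ : δ ≤ 1) {m : ℕ} (hm : 1 ≤ m) (i j : ℤ)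
    (h : (m : ℤ) ≤ |i| ∨ (m : ℤ) ≤ |j|) :
    (if δ = 0 then 3 / 4 else 1 / 3 : ℝ) * (m : ℝ) ^ 2 ≤ stackForm δ i j := by
  interval_cases δ
  · simpa using stackForm_zero_shell m i j h
  · simpa using stackForm_one_shell hm i j h

/-! ## Boxes and shells -/

/-- The boxes increase. [folklore] -/
theorem box_mono {R R' : ℕ} (h : R ≤ R') : box R ⊆ box R' := by
  intro v hv
  rw [mem_box] at hv ⊢
  have : (R : ℤ) ≤ R' := by exact_mod_cast h
  exact ⟨hv.1.trans this, hv.2.trans this⟩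

/-- Outside the box some coordinate is large. [folklore] -/
theorem not_mem_box {R : ℕ} {ij : ℤ × ℤ} :
    ij ∉ box R ↔ (R : ℤ) + 1 ≤ |ij.1| ∨ (R : ℤ) + 1 ≤ |ij.2| := by
  rw [mem_box]; omega

/-- A shell `box m ∖ box (m-1)` has `8m` sites (`m ≥ 1`). [folklore] -/
theorem card_shell {m : ℕ} (hm : 1 ≤ m) : ((box m \ box (m - 1)).card : ℝ) = 8 * (m : ℝ) := by
  rw [card_sdiff_of_subset (box_mono (Nat.sub_le m 1)), card_box, card_box]
  obtain ⟨n, rfl⟩ : ∃ n, m = n + 1 := ⟨m - 1, by omega⟩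
  simp only [Nat.add_sub_cancel]
  have h : (2 * n + 1) ^ 2 ≤ (2 * (n + 1) + 1) ^ 2 := Nat.pow_le_pow_left (by omega) 2
  have : (2 * (n + 1) + 1) ^ 2 - (2 * n + 1) ^ 2 = 8 * (n + 1) := by
    zify [h]; ring
  rw [this]; push_cast; ring

/-- `box 0 = {(0,0)}`. [folklore] -/
theorem box_zero : box 0 = {((0 : ℤ), (0 : ℤ))} := by
  ext ⟨i, j⟩
  simp [mem_box, abs_nonpos_iff]

/-- Every finite index set lies in some box. [folklore] -/
theorem exists_subset_box (S : Finset (ℤ × ℤ)) (R₀ : ℕ) : ∃ R, R₀ ≤ R ∧ S ⊆ box R := by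
  classical
  refine ⟨max R₀ (S.sup fun v => (|v.1| ⊔ |v.2|).toNat), le_max_left _ _, ?_⟩
  intro v hv
  have hle : (|v.1| ⊔ |v.2|).toNat ≤ S.sup fun v => (|v.1| ⊔ |v.2|).toNat :=
    le_sup (f := fun v => (|v.1| ⊔ |v.2|).toNat) hv
  rw [mem_box]
  have h0 : |v.1| ⊔ |v.2| ≤ ((|v.1| ⊔ |v.2|).toNat : ℤ) := Int.self_le_toNat _
  push_cast
  omega

/-! ## One shell -/

/-- **Term bound on a shell**: for `δ ≤ 1`, `s ≥ 0`, `m ≥ 1` and `ij` outside `box (m-1)`,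
`layerTerm δ n s ij ≤ ((α_δ m² + s)⁻¹)ⁿ`. [folklore] -/
theorem layerTerm_le_of_shell {δ : ℕ} (hδ : δ ≤ 1) (n : ℕ) {s : ℝ} (hs : 0 ≤ s) {m : ℕ} (hm : 1 ≤ m)
    {ij : ℤ × ℤ} (h : (m : ℤ) ≤ |ij.1| ∨ (m : ℤ) ≤ |ij.2|) :
    layerTerm δ n s ij ≤ (((if δ = 0 then 3 / 4 else 1 / 3 : ℝ) * (m : ℝ) ^ 2 + s)⁻¹) ^ n := by
  have hQ := stackForm_shell hδ hm ij.1 ij.2 h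
  have hα : (0 : ℝ) < (if δ = 0 then 3 / 4 else 1 / 3 : ℝ) * (m : ℝ) ^ 2 := by
    have : (1 : ℝ) ≤ m := by exact_mod_cast hm
    split_ifs <;> positivity
  unfold layerTerm
  have h0 : 0 ≤ (stackForm δ ij.1 ij.2 + s)⁻¹ := by
    rw [inv_nonneg]; linarith [stackForm_nonneg hδ ij.1 ij.2]
  exact pow_le_pow_left₀ h0 (inv_anti₀ (by linarith) (by linarith)) n

/-- **Sum over one shell**: `∑_{box m ∖ box (m-1)} layerTerm δ n s ≤ 8m ((α_δ m² + s)⁻¹)ⁿ`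
(`δ ≤ 1`, `s ≥ 0`, `m ≥ 1`). [folklore] -/
theorem sum_shell_le {δ : ℕ} (hδ : δ ≤ 1) (n : ℕ) {s : ℝ} (hs : 0 ≤ s) {m : ℕ} (hm : 1 ≤ m) :
    ∑ ij ∈ box m \ box (m - 1), layerTerm δ n s ij ≤
      8 * (m : ℝ) * (((if δ = 0 then 3 / 4 else 1 / 3 : ℝ) * (m : ℝ) ^ 2 + s)⁻¹) ^ n := by
  have hbound : ∀ ij ∈ box m \ box (m - 1), layerTerm δ n s ij ≤
      (((if δ = 0 then 3 / 4 else 1 / 3 : ℝ) * (m : ℝ) ^ 2 + s)⁻¹) ^ n := by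
    intro ij hij
    rw [mem_sdiff, not_mem_box] at hij
    apply layerTerm_le_of_shell hδ n hs hm
    have h1 : ((m - 1 : ℕ) : ℤ) + 1 = m := by omega
    rw [h1] at hij
    exact hij.2
  calc ∑ ij ∈ box m \ box (m - 1), layerTerm δ n s ij
      ≤ ∑ _ij ∈ box m \ box (m - 1), (((if δ = 0 then 3 / 4 else 1 / 3 : ℝ) * (m : ℝ) ^ 2 + s)⁻¹) ^ n :=
        sum_le_sum hbound
    _ = _ := by rw [sum_const, nsmul_eq_mul, card_shell hm]

/-! ## Telescoping -/

/-- **Convexity step**: for `0 < A ≤ B` and `d : ℕ`, `d (B − A) (B⁻¹)^(d+1) ≤ (A⁻¹)^d − (B⁻¹)^d`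
(from `B^d − A^d = (B − A) ∑ Bⁱ A^{d-1-i} ≥ (B − A) d A^{d-1}`). [folklore] -/
theorem inv_pow_sub_inv_pow_ge {A B : ℝ} (hA : 0 < A) (hAB : A ≤ B) (d : ℕ) :
    (d : ℝ) * (B - A) * (B⁻¹) ^ (d + 1) ≤ (A⁻¹) ^ d - (B⁻¹) ^ d := by
  have hB : 0 < B := lt_of_lt_of_le hA hAB
  -- geometric sum lower bound
  have hgeom : (∑ i ∈ range d, B ^ i * A ^ (d - 1 - i)) * (B - A) = B ^ d - A ^ d :=
    geom_sum₂_mul B A d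
  have hterm : ∀ i ∈ range d, A ^ (d - 1) ≤ B ^ i * A ^ (d - 1 - i) := by
    intro i hi
    rw [mem_range] at hi
    calc A ^ (d - 1) = A ^ i * A ^ (d - 1 - i) := by rw [← pow_add]; congr 1; omega
      _ ≤ B ^ i * A ^ (d - 1 - i) :=
        mul_le_mul_of_nonneg_right (pow_le_pow_left₀ hA.le hAB i) (by positivity)
  have hsum : (d : ℝ) * A ^ (d - 1) ≤ ∑ i ∈ range d, B ^ i * A ^ (d - 1 - i) := by
    calc (d : ℝ) * A ^ (d - 1) = ∑ _i ∈ range d, A ^ (d - 1) := by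
          rw [sum_const, card_range, nsmul_eq_mul]
      _ ≤ _ := sum_le_sum hterm
  have hdiff : (d : ℝ) * A ^ (d - 1) * (B - A) ≤ B ^ d - A ^ d := by
    rw [← hgeom]
    exact mul_le_mul_of_nonneg_right hsum (by linarith)
  -- rewrite the claim over the common denominator
  rw [inv_pow, inv_pow, inv_pow]
  rw [show (A ^ d)⁻¹ - (B ^ d)⁻¹ = (B ^ d - A ^ d) / (A ^ d * B ^ d) by
    field_simp]
  rw [show (d : ℝ) * (B - A) * (B ^ (d + 1))⁻¹ = (d : ℝ) * (B - A) / B ^ (d + 1) by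
    rw [div_eq_mul_inv]]
  rw [div_le_div_iff₀ (by positivity) (by positivity)]
  -- d (B-A) A^d B^d ≤ (B^d - A^d) B^(d+1)
  rcases Nat.eq_zero_or_pos d with rfl | hd
  · simp
  · obtain ⟨e, rfl⟩ : ∃ e, d = e + 1 := ⟨d - 1, by omega⟩
    simp only [Nat.add_sub_cancel] at hdiff
    have hBA : 0 ≤ B - A := by linarith
    have key : ((e + 1 : ℕ) : ℝ) * (B - A) * (A ^ (e + 1) * B ^ (e + 1)) =
        (((e + 1 : ℕ) : ℝ) * A ^ e * (B - A)) * (A * B ^ (e + 1)) := by ring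
    rw [key]
    calc (((e + 1 : ℕ) : ℝ) * A ^ e * (B - A)) * (A * B ^ (e + 1))
        ≤ (B ^ (e + 1) - A ^ (e + 1)) * (A * B ^ (e + 1)) :=
          mul_le_mul_of_nonneg_right hdiff (by positivity)
      _ ≤ (B ^ (e + 1) - A ^ (e + 1)) * (B * B ^ (e + 1)) := by
          apply mul_le_mul_of_nonneg_left _ (sub_nonneg.2 (pow_le_pow_left₀ hA.le hAB _))
          exact mul_le_mul_of_nonneg_right hAB (by positivity)
      _ = (B ^ (e + 1) - A ^ (e + 1)) * B ^ (e + 1 + 1) := by ring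

/-- **Telescoping step for the shell bound**: for `α > 0`, `s ≥ 0`, `m ≥ 1` with
`α (m-1)² + s > 0`, and `d : ℕ`,
`8 m ((α m² + s)⁻¹)^(d+1) ≤ (8/(α d)) · (((α (m-1)² + s)⁻¹)^d − ((α m² + s)⁻¹)^d)` (`d ≥ 1`).
[folklore] -/
theorem shell_telescope {α s : ℝ} (hα : 0 < α) (hs : 0 ≤ s) {m : ℕ} (hm : 1 ≤ m)
    (hA : 0 < α * ((m : ℝ) - 1) ^ 2 + s) {d : ℕ} (hd : 1 ≤ d) :
    8 * (m : ℝ) * ((α * (m : ℝ) ^ 2 + s)⁻¹) ^ (d + 1) ≤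
      8 / (α * d) * (((α * ((m : ℝ) - 1) ^ 2 + s)⁻¹) ^ d - ((α * (m : ℝ) ^ 2 + s)⁻¹) ^ d) := by
  set A := α * ((m : ℝ) - 1) ^ 2 + s with hAdef
  set B := α * (m : ℝ) ^ 2 + s with hBdef
  have hm1 : (1 : ℝ) ≤ m := by exact_mod_cast hm
  have hAB : A ≤ B := by
    rw [hAdef, hBdef]; nlinarith
  have hBA : B - A = α * (2 * m - 1) := by rw [hAdef, hBdef]; ring
  have hconv := inv_pow_sub_inv_pow_ge hA hAB d
  have hd' : (0 : ℝ) < d := by exact_mod_cast hd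
  have hB : 0 < B := lt_of_lt_of_le hA hAB
  -- 8 m ≤ 8 (2m - 1) = (8/(α d)) · d · (B - A)
  have h1 : 8 * (m : ℝ) * (B⁻¹) ^ (d + 1) ≤ 8 / (α * d) * ((d : ℝ) * (B - A) * (B⁻¹) ^ (d + 1)) := by
    rw [hBA]
    have e1 : 8 / (α * d) * ((d : ℝ) * (α * (2 * m - 1)) * (B⁻¹) ^ (d + 1)) =
        8 * (2 * m - 1) * (B⁻¹) ^ (d + 1) := by
      field_simp
    rw [e1]
    have : (0 : ℝ) ≤ (B⁻¹) ^ (d + 1) := by positivity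
    nlinarith
  exact h1.trans (mul_le_mul_of_nonneg_left hconv (by positivity))

/-- **Telescoped shell bound**: for `α > 0`, `s ≥ 0`, `d ≥ 1`, `R ≤ R'` with `α R² + s > 0`,
`∑_{m=R+1}^{R'} 8m ((α m² + s)⁻¹)^(d+1) ≤ (8/(α d)) ((α R² + s)⁻¹)^d`. [folklore] -/
theorem sum_Ioc_shell_le {α s : ℝ} (hα : 0 < α) (hs : 0 ≤ s) {d : ℕ} (hd : 1 ≤ d) {R R' : ℕ}
    (hR : 0 < α * (R : ℝ) ^ 2 + s) (h : R ≤ R') :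
    ∑ m ∈ Ioc R R', 8 * (m : ℝ) * ((α * (m : ℝ) ^ 2 + s)⁻¹) ^ (d + 1) ≤
      8 / (α * d) * (((α * (R : ℝ) ^ 2 + s)⁻¹) ^ d - ((α * (R' : ℝ) ^ 2 + s)⁻¹) ^ d) := by
  induction R', h using Nat.le_induction with
  | base => simp
  | succ R' hRR' ih =>
    rw [sum_Ioc_succ_top hRR']
    have hA : 0 < α * (((R' + 1 : ℕ) : ℝ) - 1) ^ 2 + s := by
      push_cast
      rw [show (R' : ℝ) + 1 - 1 = R' by ring]
      have : (R : ℝ) ^ 2 ≤ (R' : ℝ) ^ 2 := by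
        have : (R : ℝ) ≤ R' := by exact_mod_cast hRR'
        exact pow_le_pow_left₀ (by positivity) this 2
      nlinarith
    have hstep := shell_telescope hα hs (m := R' + 1) (by omega) hA hd
    push_cast at hstep ⊢
    rw [show (R' : ℝ) + 1 - 1 = R' by ring] at hstep
    linarith

/-- **Box differences are below the tail bound**: for `δ ≤ 1`, `s ≥ 0`, `d ≥ 1` and `R ≤ R'` with
`α_δ R² + s > 0`, `∑_{box R' ∖ box R} layerTerm δ (d+1) s ≤ (8/(α_δ d)) ((α_δ R² + s)⁻¹)^d`.
[folklore] -/
theorem sum_sdiff_box_le {δ : ℕ} (hδ : δ ≤ 1) {s : ℝ} (hs : 0 ≤ s) {d : ℕ} (hd : 1 ≤ d) {R R' : ℕ}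
    (hR : 0 < (if δ = 0 then 3 / 4 else 1 / 3 : ℝ) * (R : ℝ) ^ 2 + s) (h : R ≤ R') :
    ∑ ij ∈ box R' \ box R, layerTerm δ (d + 1) s ij ≤
      8 / ((if δ = 0 then 3 / 4 else 1 / 3 : ℝ) * d) *
        (((if δ = 0 then 3 / 4 else 1 / 3 : ℝ) * (R : ℝ) ^ 2 + s)⁻¹) ^ d := by
  set α : ℝ := (if δ = 0 then 3 / 4 else 1 / 3 : ℝ) with hαdef
  have hα : 0 < α := by rw [hαdef]; split_ifs <;> norm_num
  have main : ∑ ij ∈ box R' \ box R, layerTerm δ (d + 1) s ij ≤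
      ∑ m ∈ Ioc R R', 8 * (m : ℝ) * ((α * (m : ℝ) ^ 2 + s)⁻¹) ^ (d + 1) := by
    induction R', h using Nat.le_induction with
    | base => simp
    | succ R' hRR' ih =>
      have hsplit : box (R' + 1) \ box R = (box (R' + 1) \ box R') ∪ (box R' \ box R) :=
        (sdiff_union_sdiff_cancel (box_mono (Nat.le_succ R')) (box_mono hRR')).symm
      have hdisj : Disjoint (box (R' + 1) \ box R') (box R' \ box R) :=
        disjoint_left.2 fun v h1 h2 => (mem_sdiff.1 h1).2 (mem_sdiff.1 h2).1
      rw [hsplit, sum_union hdisj, sum_Ioc_succ_top hRR']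
      have hshell := sum_shell_le hδ (d + 1) hs (m := R' + 1) (by omega)
      rw [show R' + 1 - 1 = R' from rfl] at hshell
      rw [← hαdef] at hshell
      push_cast at hshell ⊢
      linarith
  refine main.trans ?_
  have htel := sum_Ioc_shell_le hα hs hd hR h
  have hdrop : 8 / (α * d) * (((α * (R : ℝ) ^ 2 + s)⁻¹) ^ d - ((α * (R' : ℝ) ^ 2 + s)⁻¹) ^ d) ≤
      8 / (α * d) * ((α * (R : ℝ) ^ 2 + s)⁻¹) ^ d := by
    have h0 : 0 ≤ ((α * (R' : ℝ) ^ 2 + s)⁻¹) ^ d := by positivity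
    have h1 : 0 ≤ 8 / (α * d) := by positivity
    nlinarith
  exact htel.trans hdrop

/-- **Finite sums are bounded by box + tail** (`δ ≤ 1`, `s ≥ 0`, `d ≥ 1`, `α_δ R² + s > 0`).
[folklore] -/
theorem sum_le_box_add_tail {δ : ℕ} (hδ : δ ≤ 1) {s : ℝ} (hs : 0 ≤ s) {d : ℕ} (hd : 1 ≤ d) {R : ℕ}
    (hR : 0 < (if δ = 0 then 3 / 4 else 1 / 3 : ℝ) * (R : ℝ) ^ 2 + s) (S : Finset (ℤ × ℤ)) :
    ∑ ij ∈ S, layerTerm δ (d + 1) s ij ≤ ∑ ij ∈ box R, layerTerm δ (d + 1) s ij +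
      8 / ((if δ = 0 then 3 / 4 else 1 / 3 : ℝ) * d) *
        (((if δ = 0 then 3 / 4 else 1 / 3 : ℝ) * (R : ℝ) ^ 2 + s)⁻¹) ^ d := by
  obtain ⟨R', hRR', hS⟩ := exists_subset_box S R
  calc ∑ ij ∈ S, layerTerm δ (d + 1) s ij ≤ ∑ ij ∈ box R', layerTerm δ (d + 1) s ij :=
        sum_le_sum_of_subset_of_nonneg hS fun v _ _ => layerTerm_nonneg hδ _ hs v
    _ = ∑ ij ∈ box R' \ box R, layerTerm δ (d + 1) s ij + ∑ ij ∈ box R, layerTerm δ (d + 1) s ij :=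
        (sum_sdiff (box_mono hRR')).symm
    _ ≤ _ := by
        have := sum_sdiff_box_le hδ hs hd hR hRR'
        linarith

/-- **Summability of the layer sums** for `δ ≤ 1`, `s ≥ 0`, `n ≥ 2`. [folklore] -/
theorem layerTerm_summable {δ : ℕ} (hδ : δ ≤ 1) {s : ℝ} (hs : 0 ≤ s) {n : ℕ} (hn : 2 ≤ n) :
    Summable (layerTerm δ n s) := by
  obtain ⟨d, rfl⟩ : ∃ d, n = d + 1 := ⟨n - 1, by omega⟩
  have hR : 0 < (if δ = 0 then 3 / 4 else 1 / 3 : ℝ) * ((1 : ℕ) : ℝ) ^ 2 + s := by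
    split_ifs <;> norm_num <;> linarith
  exact summable_of_sum_le (fun v => layerTerm_nonneg hδ _ hs v)
    (sum_le_box_add_tail hδ hs (by omega) hR)

/-- **Lower bound**: `∑_{box R} layerTerm ≤ layerSum` (`δ ≤ 1`, `s ≥ 0`, `n ≥ 2`). [folklore] -/
theorem sum_box_le_layerSum {δ : ℕ} (hδ : δ ≤ 1) {s : ℝ} (hs : 0 ≤ s) {n : ℕ} (hn : 2 ≤ n) (R : ℕ) :
    ∑ ij ∈ box R, layerTerm δ n s ij ≤ layerSum δ n s :=
  (layerTerm_summable hδ hs hn).sum_le_tsum (box R) fun v _ => layerTerm_nonneg hδ _ hs v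

/-- **Upper bound**: `layerSum δ (d+1) s ≤ ∑_{box R} layerTerm + (8/(α_δ d)) ((α_δ R² + s)⁻¹)^d`
(`δ ≤ 1`, `s ≥ 0`, `d ≥ 1`, `α_δ R² + s > 0`). [folklore] -/
theorem layerSum_le_box_add_tail {δ : ℕ} (hδ : δ ≤ 1) {s : ℝ} (hs : 0 ≤ s) {d : ℕ} (hd : 1 ≤ d)
    {R : ℕ} (hR : 0 < (if δ = 0 then 3 / 4 else 1 / 3 : ℝ) * (R : ℝ) ^ 2 + s) :
    layerSum δ (d + 1) s ≤ ∑ ij ∈ box R, layerTerm δ (d + 1) s ij +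
      8 / ((if δ = 0 then 3 / 4 else 1 / 3 : ℝ) * d) *
        (((if δ = 0 then 3 / 4 else 1 / 3 : ℝ) * (R : ℝ) ^ 2 + s)⁻¹) ^ d :=
  Real.tsum_le_of_sum_le (fun v => layerTerm_nonneg hδ _ hs v) (sum_le_box_add_tail hδ hs hd hR)

/-- **The tail over the complement of a box**: `∑'_{ij ∉ box R} layerTerm δ (d+1) s ij ≤
(8/(α_δ d)) ((α_δ R² + s)⁻¹)^d`, and it is nonnegative. [folklore] -/
theorem tsum_compl_box_le {δ : ℕ} (hδ : δ ≤ 1) {s : ℝ} (hs : 0 ≤ s) {d : ℕ} (hd : 1 ≤ d)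
    {R : ℕ} (hR : 0 < (if δ = 0 then 3 / 4 else 1 / 3 : ℝ) * (R : ℝ) ^ 2 + s) :
    ∑' ij : {ij : ℤ × ℤ // ij ∉ box R}, layerTerm δ (d + 1) s ij ≤
      8 / ((if δ = 0 then 3 / 4 else 1 / 3 : ℝ) * d) *
        (((if δ = 0 then 3 / 4 else 1 / 3 : ℝ) * (R : ℝ) ^ 2 + s)⁻¹) ^ d := by
  have hsum := layerTerm_summable hδ hs (show 2 ≤ d + 1 by omega)
  have hsplit : ∑ ij ∈ box R, layerTerm δ (d + 1) s ij +
      ∑' ij : {ij : ℤ × ℤ // ij ∉ box R}, layerTerm δ (d + 1) s ij = ∑' ij, layerTerm δ (d + 1) s ij :=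
    hsum.sum_add_tsum_compl (s := box R)
  have hup := layerSum_le_box_add_tail hδ hs hd hR
  unfold layerSum at hup
  linarith

/-- The layer sum splits as box part plus complement tail. [folklore] -/
theorem layerSum_eq_sum_box_add_tsum_compl {δ : ℕ} (hδ : δ ≤ 1) {s : ℝ} (hs : 0 ≤ s) {n : ℕ}
    (hn : 2 ≤ n) (R : ℕ) :
    layerSum δ n s = ∑ ij ∈ box R, layerTerm δ n s ij +
      ∑' ij : {ij : ℤ × ℤ // ij ∉ box R}, layerTerm δ n s ij := by
  have h : ∑ ij ∈ box R, layerTerm δ n s ij +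
      ∑' ij : {ij : ℤ × ℤ // ij ∉ box R}, layerTerm δ n s ij = ∑' ij, layerTerm δ n s ij :=
    (layerTerm_summable hδ hs hn).sum_add_tsum_compl (s := box R)
  exact h.symm

/-- **Full-layer bound**: for `s > 0`, `layerSum δ (d+1) s ≤ (s⁻¹)^(d+1) + (8/(α_δ d)) (s⁻¹)^d`
(the box `R = 0` is the single site `(0,0)`, whose term is at most `s^{-(d+1)}`). [folklore] -/
theorem layerSum_le_of_pos {δ : ℕ} (hδ : δ ≤ 1) {s : ℝ} (hs : 0 < s) {d : ℕ} (hd : 1 ≤ d) :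
    layerSum δ (d + 1) s ≤ (s⁻¹) ^ (d + 1) + 8 / ((if δ = 0 then 3 / 4 else 1 / 3 : ℝ) * d) * (s⁻¹) ^ d := by
  have hR : 0 < (if δ = 0 then 3 / 4 else 1 / 3 : ℝ) * ((0 : ℕ) : ℝ) ^ 2 + s := by simpa using hs
  have h := layerSum_le_box_add_tail hδ hs.le hd hR
  simp only [Nat.cast_zero] at h
  rw [box_zero, sum_singleton] at h
  have h0 : layerTerm δ (d + 1) s ((0 : ℤ), (0 : ℤ)) ≤ (s⁻¹) ^ (d + 1) := by
    unfold layerTerm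
    have hQ : 0 ≤ stackForm δ 0 0 := stackForm_nonneg hδ 0 0
    exact pow_le_pow_left₀ (by rw [inv_nonneg]; linarith) (inv_anti₀ hs (by simpa using hQ)) _
  have e : (if δ = 0 then 3 / 4 else 1 / 3 : ℝ) * (0 : ℝ) ^ 2 + s = s := by ring
  rw [e] at h
  linarith

/-- The layer sums are nonnegative. [folklore] -/
theorem layerSum_nonneg {δ : ℕ} (hδ : δ ≤ 1) (n : ℕ) {s : ℝ} (hs : 0 ≤ s) : 0 ≤ layerSum δ n s :=
  tsum_nonneg fun v => layerTerm_nonneg hδ n hs v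

end Literature.MathematicalPhysics.StatisticalMechanics.StackingSums

end
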